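import Summits.QuantumFields.YangMills.Theorems.BalabanUVNodesN09CentralWindowNondegenerateBase
import HarnessLib

/-!
# BalabanUVNodes ∕ N09 — NON-DEGENERACY OF THE CHART READ OF THE (0.4) FIBRE MAP AT EVERY POINT OF THE CENTRAL `α`-WINDOW (FILE 10 = INTENT-6d, part 2)

Cell `pub-ymgap` (YM-PLAN Track A), width seat `pub-ymgap-dag-n09-w4` g5; count-neutral helper of K1⁹ = stmt-QuantumFields-27364 (`--supports`, `--as helper`).  [I] = [Balaban1987RG1].
The `hjac0` input of dag-n09-w6's `exists_perBondCharts_of_forwardLaws`: the density of the forward law of `…N09CentralWindowForwardLaw` does not vanish on the window.  Non-degeneracy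
at a window point is n07-w2's onto central response ([Balaban1985Averaging] Prop. 3); it is moved to every point of the ONE chart at `b = V_{i₀}` by the transition cocycle of the
exponential chart ([Helgason2000] Ch. I Thm 1.14 (12)).

WHAT IS PROVED (0 def, 0 sorry).  §3 `continuousAt_modelProduct` · ★★★ `det_sliceDeriv_ne_zero_of_mem` — ONE chart at `b = V_{i₀}`: `det D_XΦ((V(U),↑b), X₁) ≠ 0` at every `X₁` of the chart
ball with `b·Θ(X₁)` in the window; near `X₁` the slice factors as `T_{k₂} ∘ σ_{W₁} ∘ T_{k₁}` through p28's transition maps (`k₁ = W₁⁻¹b`, `k₂ = E(b)⁻¹E(W₁)`, `expChart_transition`), the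
transitions are non-degenerate (`…N09ForwardLawTools`) and `σ_{W₁}` is non-degenerate at `0` (part 1).  §4 `jacDensity_ne_zero_of_norm_lt` · ★★★ `jacobian_ne_zero_and_ne_top_of_mem` — the
density `J(W)` of `…N09CentralWindowForwardLaw` is `≠ 0` and `≠ ⊤` at every window point · `modelChart_at_logChart_eq` (on the window the first factor reads `Λ(E(b)⁻¹E(W))`).

HONEST FRAMING.  Count-neutral; classical Lie-group chart calculus ∕ change of variables BY NAME on the tree's typed (0.4) objects; nothing of Bałaban's estimates asserted;
`hreg` NOT discharged; N09 NOT discharged; conjunct 1 (Lemma 4) ∕ FLAG №7 untouched; K0⁷ ∕ K1⁹ ∕ K3⁸ NOT closed; counts unmoved; one finite four-torus programme at fixed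
`ε = L^{−K}` — R4 closes the conditional rung `BalabanLadder.UV` only; NOT ℝ⁴ ∕ infinite volume ∕ OS; the Yang–Mills mass gap (Clay) is NOT proved by any of this.
-/

noncomputable section

open scoped Matrix.Norms.L2Operator Topology ContDiff ENNReal
open Filter Set Function MeasureTheory NormedSpace

namespace Summit.QuantumFields.YangMills.BalabanUVNodes.N09CentralWindowNondegenerate

open Literature.MathematicalPhysics.QuantumFieldTheory.Balaban1983to89
open Literature.MathematicalPhysics.QuantumFieldTheory.Balaban1983to89.HaarExponentialChart
open Literature.MathematicalPhysics.QuantumFieldTheory.Balaban1983to89.HaarExponentialChart.IsChartRep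
open Literature.MathematicalPhysics.QuantumFieldTheory.Balaban1983to89.BlockAveraging (Small Idx avgFun loopHol instNonemptyIdx)
open Literature.MathematicalPhysics.QuantumFieldTheory.Balaban1983to89.BlockAveragingHaarAC (centralBond pre post openHol IsCentral)
open Literature.MathematicalPhysics.QuantumFieldTheory.Balaban1983to89.BlockAveragingEMLHaarAC (fibreFamily fibreMap FibreSmall fibreGuard
  fibreFamily_of_isCentral coe_fibreFamily_of_not_isCentral dist1_fibreFamily_of_not_isCentral fibreMap_of_mem avgFun_update_centralBond_self
  small_update_centralBond_self_iff loopHol_update_centralBond_self isOpen_fibreGuard)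
open Literature.MathematicalPhysics.QuantumFieldTheory.Balaban1983to89.ExpMeanLog (eml expMeanLogSU deltaSU)
open Literature.MathematicalPhysics.QuantumFieldTheory.Balaban1983to89.MatrixLog (mlog)
open Literature.MathematicalPhysics.QuantumFieldTheory.Balaban1983to89.Node00
open Literature.MathematicalPhysics.QuantumLattice (fundamentalRep fundamentalRep_apply)
open Summit.QuantumFields.YangMills.BalabanUVNodes.N09ChartReadAveragingSmooth (coe_fderiv_apply_eq hasDerivAt_along_ray)
open Summit.QuantumFields.YangMills.BalabanUVNodes.N09ChartReadAveragingSubmersion (conj_mem_lie)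
open Summit.QuantumFields.YangMills.BalabanUVNodes.N09ForwardLawTools
open Summit.QuantumFields.YangMills.BalabanUVNodes.N09CentralWindowChart

variable {P : Params} {j : ℕ} {N : ℕ} [NeZero N]

/-! ## §3  Non-degeneracy at EVERY point of the window for the chart at `b = V_{i₀}`: the transition cocycle `σ_b = T₂ ∘ σ_{W₁} ∘ T₁` near `X₁` -/

section Cocycle

/-- Continuity of the model product `X ↦ Ê(V,B)⋆ · Ê(V, B·e^X)` at a point whose family is inside `‖· − 1‖ < 1`. [cite: Balaban1987RG1, (0.4) p.253 (bookkeeping)] -/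
theorem continuousAt_modelProduct (c : PBond P (j + 1)) (EE : (Idx P → Matrix (Fin N) (Fin N) ℂ) → Matrix (Fin N) (Fin N) ℂ → Matrix (Fin N) (Fin N) ℂ)
    (hEE : ∀ V A, EE V A = eml (fun i : Idx P => if IsCentral c i then (1 : Matrix (Fin N) (Fin N) ℂ) else V i * star A) * A)
    {V : Idx P → Matrix (Fin N) (Fin N) ℂ} {B : Matrix (Fin N) (Fin N) ℂ} {X₀ : (specialUnitaryLogChart (Fin N)).lie}
    (h1 : ∀ i, ¬ IsCentral c i → ‖V i * star (B * exp ((X₀ : (specialUnitaryLogChart (Fin N)).lie) : Matrix (Fin N) (Fin N) ℂ)) - 1‖ < 1) :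
    ContinuousAt (fun X : (specialUnitaryLogChart (Fin N)).lie => star (EE V B) * EE V (B * exp ((X : (specialUnitaryLogChart (Fin N)).lie) : Matrix (Fin N) (Fin N) ℂ))) X₀ := by
  have hEc : ContinuousAt (fun q' : (Idx P → Matrix (Fin N) (Fin N) ℂ) × Matrix (Fin N) (Fin N) ℂ => EE q'.1 q'.2)
      (V, B * exp ((X₀ : (specialUnitaryLogChart (Fin N)).lie) : Matrix (Fin N) (Fin N) ℂ)) := (contDiffAt_modelE c EE hEE h1).continuousAt
  have hin : Continuous fun X : (specialUnitaryLogChart (Fin N)).lie => (V, B * exp ((X : (specialUnitaryLogChart (Fin N)).lie) : Matrix (Fin N) (Fin N) ℂ)) :=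
    continuous_const.prodMk (continuous_const.mul ((Literature.Analysis.Calculus.contDiff_exp (𝔸 := Matrix (Fin N) (Fin N) ℂ) (m := ⊤)).continuous.comp
      continuous_subtype_val))
  exact continuousAt_const.mul (ContinuousAt.comp (g := fun q' : (Idx P → Matrix (Fin N) (Fin N) ℂ) × Matrix (Fin N) (Fin N) ℂ => EE q'.1 q'.2)
    (f := fun X : (specialUnitaryLogChart (Fin N)).lie => (V, B * exp ((X : (specialUnitaryLogChart (Fin N)).lie) : Matrix (Fin N) (Fin N) ℂ))) (x := X₀) hEc hin.continuousAt)

/-- ★★★ **NON-DEGENERACY OF THE CHART READ AT EVERY WINDOW POINT, ONE CHART AT `b = V_{i₀}`.**  For `X₁` in the chart ball with `W₁ = b·Θ(X₁)` in the central `α`-window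
(`0 ≤ α ≤ 1∕24`, `64·α ≤ δ_N`, `157·α < L^{−(d−1)}`):  `det D_XΦ((V(U),↑b), X₁) ≠ 0`.  Near `X₁` the slice at base `b` factors as `T_{k₂} ∘ σ_{W₁} ∘ T_{k₁}` with the chart's
transition maps (`k₁ = W₁⁻¹b`, `k₂ = E(b)⁻¹E(W₁)`), whose derivatives are non-degenerate (`…N09ForwardLawTools`), and `σ_{W₁}` is non-degenerate at `0` (§2).
[cite: Helgason2000, Ch. I §1 Thm. 1.14 (12)-(13) p. 96; Balaban1987RG1, (2.10) p.267; Balaban1985Averaging, Prop. 3 (124) p.36] -/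
theorem det_sliceDeriv_ne_zero_of_mem (hj : j + 1 ≤ P.m + P.K) (U : GaugeField P j (SU N)) (c : PBond P (j + 1)) {α : ℝ}
    (hα0 : 0 ≤ α) (hα24 : α ≤ 1 / 24) (hα64 : 64 * α ≤ deltaSU (Fin N)) (hαL : 157 * α < ((P.L : ℝ) ^ (P.d - 1))⁻¹)
    {i₀ : Idx P} (hi₀ : ¬ IsCentral c i₀)
    (EE : (Idx P → Matrix (Fin N) (Fin N) ℂ) → Matrix (Fin N) (Fin N) ℂ → Matrix (Fin N) (Fin N) ℂ)
    (hEE : ∀ V A, EE V A = eml (fun i : Idx P => if IsCentral c i then (1 : Matrix (Fin N) (Fin N) ℂ) else V i * star A) * A)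
    (Φ : ((Idx P → Matrix (Fin N) (Fin N) ℂ) × Matrix (Fin N) (Fin N) ℂ) × (specialUnitaryLogChart (Fin N)).lie → (specialUnitaryLogChart (Fin N)).lie)
    (hΦ : ∀ p, Φ p = HaarExpChartLocal.proj (specialUnitaryLogChart (Fin N))
      (mlog (star (EE p.1.1 p.1.2) * EE p.1.1 (p.1.2 * exp ((p.2 : (specialUnitaryLogChart (Fin N)).lie) : Matrix (Fin N) (Fin N) ℂ)))))
    {X₁ : (specialUnitaryLogChart (Fin N)).lie} (hX₁ : ‖X₁‖ < chartRadius (specialUnitaryLogChart (Fin N)))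
    (hW₁ : ∀ i : Idx P, dist1 (fibreFamily U c (openHol U c i₀ * (isChartRep_specialUnitaryGroup (n := Fin N)).expChart X₁) i) ≤ α) :
    ((fderiv ℝ Φ ((fun i => ((openHol U c i : SU N) : Matrix (Fin N) (Fin N) ℂ), ((openHol U c i₀ : SU N) : Matrix (Fin N) (Fin N) ℂ)), X₁)).comp
      (ContinuousLinearMap.inr ℝ ((Idx P → Matrix (Fin N) (Fin N) ℂ) × Matrix (Fin N) (Fin N) ℂ) (specialUnitaryLogChart (Fin N)).lie)).det ≠ 0 := by
  obtain ⟨h19r, h38s, h19half, h2αδ, h19one⟩ := radii_of_le_deltaSU (N := N) hα0 hα64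
  have hαδ : α < deltaSU (Fin N) := by linarith
  -- abbreviations
  obtain ⟨h, hh⟩ : ∃ h', h' = isChartRep_specialUnitaryGroup (n := Fin N) := ⟨_, rfl⟩
  obtain ⟨E, hE⟩ : ∃ E', E' = fibreMap (expMeanLogSU (n := Fin N)) U c := ⟨_, rfl⟩
  obtain ⟨b, hb⟩ : ∃ b', b' = openHol U c i₀ := ⟨_, rfl⟩
  obtain ⟨W₁, hW₁def⟩ : ∃ W', W' = b * h.expChart X₁ := ⟨_, rfl⟩
  obtain ⟨V, hV⟩ : ∃ V' : Idx P → Matrix (Fin N) (Fin N) ℂ, V' = fun i => ((openHol U c i : SU N) : Matrix (Fin N) (Fin N) ℂ) := ⟨_, rfl⟩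
  have hW₁' : ∀ i : Idx P, dist1 (fibreFamily U c W₁ i) ≤ α := by rw [hW₁def, hh, hb]; exact hW₁
  have hW₁s : FibreSmall (expMeanLogSU (n := Fin N)) U c W₁ := fibreSmall_of_mem_window U c hαδ hW₁'
  have hbs : FibreSmall (expMeanLogSU (n := Fin N)) U c b := by rw [hb]; exact fibreSmall_openHol_of_mem_window U c hα0 h2αδ hW₁' hi₀
  have hcoeW₁ : (b : Matrix (Fin N) (Fin N) ℂ) * exp ((X₁ : (specialUnitaryLogChart (Fin N)).lie) : Matrix (Fin N) (Fin N) ℂ) = (W₁ : Matrix (Fin N) (Fin N) ℂ) := by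
    rw [hW₁def, Submonoid.coe_mul, hh, coe_expChart_SU]
  have hfamW₁ : ∀ i, ¬ IsCentral c i → ‖V i * star (W₁ : Matrix (Fin N) (Fin N) ℂ) - 1‖ < 1 := by
    intro i hi; rw [hV]; dsimp only; rw [norm_coe_mul_star_sub_one]; exact (norm_openHol_sub_le_of_mem U c hW₁' hi).trans_lt (by linarith)
  have hfamb : ∀ i, ¬ IsCentral c i → ‖V i * star (b : Matrix (Fin N) (Fin N) ℂ) - 1‖ < 1 := by
    intro i hi; rw [hV]; dsimp only; rw [norm_coe_mul_star_sub_one]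
    have := norm_openHol_sub_openHol_le U c hW₁' hi hi₀; rw [← hb] at this; linarith
  have hk₂norm : ‖(((E b)⁻¹ * E W₁ : SU N) : Matrix (Fin N) (Fin N) ℂ) - 1‖ ≤ 19 * α := by
    rw [hE, hb]; exact norm_coe_fibreMap_inv_mul_sub_one_le U c hα0 (by linarith) h2αδ hW₁' hi₀
  have hk₂mem : (E b)⁻¹ * E W₁ ∈ h.window (chartRadius (specialUnitaryLogChart (Fin N))) := by
    rw [hh]; exact mem_window_of_norm_sub_one_le hk₂norm h19r h38s h19half
  -- abbreviations for the slices and the transition elements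
  obtain ⟨σ, hσ⟩ : ∃ σ' : (specialUnitaryLogChart (Fin N)).lie → (specialUnitaryLogChart (Fin N)).lie, σ' = fun X => Φ ((V, (b : Matrix (Fin N) (Fin N) ℂ)), X) := ⟨_, rfl⟩
  obtain ⟨σ₁, hσ₁⟩ : ∃ σ' : (specialUnitaryLogChart (Fin N)).lie → (specialUnitaryLogChart (Fin N)).lie, σ' = fun Y => Φ ((V, (W₁ : Matrix (Fin N) (Fin N) ℂ)), Y) := ⟨_, rfl⟩
  obtain ⟨k₁, hk₁⟩ : ∃ k : SU N, k = W₁⁻¹ * b := ⟨_, rfl⟩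
  obtain ⟨k₂, hk₂⟩ : ∃ k : SU N, k = (E b)⁻¹ * E W₁ := ⟨_, rfl⟩
  have hk₁X₁ : k₁ * h.expChart X₁ = 1 := by rw [hk₁, mul_assoc, ← hW₁def, inv_mul_cancel]
  -- the model identities at the two base points
  have hmodel_b : ∀ {X : (specialUnitaryLogChart (Fin N)).lie}, FibreSmall (expMeanLogSU (n := Fin N)) U c (b * (isChartRep_specialUnitaryGroup (n := Fin N)).expChart X) →
      star (EE V (b : Matrix (Fin N) (Fin N) ℂ)) * EE V ((b : Matrix (Fin N) (Fin N) ℂ) * exp ((X : (specialUnitaryLogChart (Fin N)).lie) : Matrix (Fin N) (Fin N) ℂ)) =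
        (((E b)⁻¹ * E (b * (isChartRep_specialUnitaryGroup (n := Fin N)).expChart X) : SU N) : Matrix (Fin N) (Fin N) ℂ) := by
    intro X hX; rw [hV, hE]; exact star_modelE_mul_modelE_eq_coe U c EE hEE hbs hX
  have hmodel_W₁ : ∀ {Y : (specialUnitaryLogChart (Fin N)).lie}, FibreSmall (expMeanLogSU (n := Fin N)) U c (W₁ * (isChartRep_specialUnitaryGroup (n := Fin N)).expChart Y) →
      star (EE V (W₁ : Matrix (Fin N) (Fin N) ℂ)) * EE V ((W₁ : Matrix (Fin N) (Fin N) ℂ) * exp ((Y : (specialUnitaryLogChart (Fin N)).lie) : Matrix (Fin N) (Fin N) ℂ)) =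
        (((E W₁)⁻¹ * E (W₁ * (isChartRep_specialUnitaryGroup (n := Fin N)).expChart Y) : SU N) : Matrix (Fin N) (Fin N) ℂ) := by
    intro Y hY; rw [hV, hE]; exact star_modelE_mul_modelE_eq_coe U c EE hEE hW₁s hY
  have hbX₁s : FibreSmall (expMeanLogSU (n := Fin N)) U c (b * (isChartRep_specialUnitaryGroup (n := Fin N)).expChart X₁) := by rw [← hh, ← hW₁def]; exact hW₁s
  have hW₁0s : FibreSmall (expMeanLogSU (n := Fin N)) U c (W₁ * (isChartRep_specialUnitaryGroup (n := Fin N)).expChart 0) := by rw [IsChartRep.expChart_zero, mul_one]; exact hW₁s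
  have hone_W₁ : star (EE V (W₁ : Matrix (Fin N) (Fin N) ℂ)) * EE V ((W₁ : Matrix (Fin N) (Fin N) ℂ) * exp (((0 : (specialUnitaryLogChart (Fin N)).lie) : (specialUnitaryLogChart (Fin N)).lie) : Matrix (Fin N) (Fin N) ℂ)) = 1 := by
    rw [hmodel_W₁ hW₁0s, IsChartRep.expChart_zero, mul_one, inv_mul_cancel, OneMemClass.coe_one]
  -- eventual conditions near `X₁`
  have evA : ∀ᶠ X in 𝓝 X₁, FibreSmall (expMeanLogSU (n := Fin N)) U c (b * (isChartRep_specialUnitaryGroup (n := Fin N)).expChart X) := by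
    have hc : Continuous fun X : (specialUnitaryLogChart (Fin N)).lie => b * (isChartRep_specialUnitaryGroup (n := Fin N)).expChart X := continuous_const.mul (isChartRep_specialUnitaryGroup (n := Fin N)).continuous_expChart
    exact hc.continuousAt.preimage_mem_nhds ((isOpen_fibreGuard (n := Fin N) U c).mem_nhds hbX₁s)
  have hopenM : IsOpen {Mx : Matrix (Fin N) (Fin N) ℂ | ‖Mx - 1‖ < innerRadius (specialUnitaryLogChart (Fin N))} :=
    isOpen_lt (continuous_id.sub continuous_const).norm continuous_const
  have evB : ∀ᶠ X in 𝓝 X₁, ‖star (EE V (b : Matrix (Fin N) (Fin N) ℂ)) * EE V ((b : Matrix (Fin N) (Fin N) ℂ) * exp ((X : (specialUnitaryLogChart (Fin N)).lie) : Matrix (Fin N) (Fin N) ℂ)) - 1‖ < innerRadius (specialUnitaryLogChart (Fin N)) := by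
    have hc := continuousAt_modelProduct c EE hEE (V := V) (B := (b : Matrix (Fin N) (Fin N) ℂ)) (X₀ := X₁) (by rw [hcoeW₁]; exact hfamW₁)
    refine hc.preimage_mem_nhds (hopenM.mem_nhds ?_)
    show ‖star (EE V (b : Matrix (Fin N) (Fin N) ℂ)) * EE V ((b : Matrix (Fin N) (Fin N) ℂ) * exp ((X₁ : (specialUnitaryLogChart (Fin N)).lie) : Matrix (Fin N) (Fin N) ℂ)) - 1‖ < _
    rw [hmodel_b hbX₁s, ← hh, ← hW₁def]; exact hk₂norm.trans_lt h19r
  have evC : ∀ᶠ X in 𝓝 X₁, k₁ * h.expChart X ∈ h.window (chartRadius (specialUnitaryLogChart (Fin N))) := by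
    have hc : Continuous fun X : (specialUnitaryLogChart (Fin N)).lie => k₁ * h.expChart X := by rw [hh]; exact continuous_const.mul (isChartRep_specialUnitaryGroup (n := Fin N)).continuous_expChart
    refine hc.continuousAt.preimage_mem_nhds ?_
    rw [hh] at hk₁X₁ ⊢
    refine ((isChartRep_specialUnitaryGroup (n := Fin N)).isOpen_window le_rfl).mem_nhds ?_
    show k₁ * (isChartRep_specialUnitaryGroup (n := Fin N)).expChart X₁ ∈ _
    rw [hk₁X₁]; exact (isChartRep_specialUnitaryGroup (n := Fin N)).one_mem_window chartRadius_pos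
  have hT₁ := differentiableAt_transition_and_det_ne_zero (isChartRep_specialUnitaryGroup (n := Fin N)) (lie_adStable_specialUnitaryGroup (n := Fin N)) (k := k₁) hX₁
    (by rw [hh] at hk₁X₁; rw [hk₁X₁]; exact (isChartRep_specialUnitaryGroup (n := Fin N)).one_mem_window chartRadius_pos)
  have hT₁0 : (isChartRep_specialUnitaryGroup (n := Fin N)).transition k₁ X₁ = 0 := by
    show (isChartRep_specialUnitaryGroup (n := Fin N)).logChart (k₁ * (isChartRep_specialUnitaryGroup (n := Fin N)).expChart X₁) = 0
    rw [hh] at hk₁X₁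
    rw [hk₁X₁, ← (isChartRep_specialUnitaryGroup (n := Fin N)).expChart_zero, (isChartRep_specialUnitaryGroup (n := Fin N)).logChart_expChart (by rw [norm_zero]; exact chartRadius_pos)]
  have evD : ∀ᶠ X in 𝓝 X₁, ‖star (EE V (W₁ : Matrix (Fin N) (Fin N) ℂ)) * EE V ((W₁ : Matrix (Fin N) (Fin N) ℂ) * exp ((((isChartRep_specialUnitaryGroup (n := Fin N)).transition k₁ X : (specialUnitaryLogChart (Fin N)).lie) : (specialUnitaryLogChart (Fin N)).lie) : Matrix (Fin N) (Fin N) ℂ)) - 1‖ <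
      innerRadius (specialUnitaryLogChart (Fin N)) := by
    have hc0 := continuousAt_modelProduct c EE hEE (V := V) (B := (W₁ : Matrix (Fin N) (Fin N) ℂ)) (X₀ := (0 : (specialUnitaryLogChart (Fin N)).lie))
      (by intro i hi; rw [ZeroMemClass.coe_zero, exp_zero, mul_one]; exact hfamW₁ i hi)
    have hc := ContinuousAt.comp_of_eq hc0 hT₁.1.continuousAt hT₁0
    refine hc.preimage_mem_nhds (hopenM.mem_nhds ?_)
    show ‖star (EE V (W₁ : Matrix (Fin N) (Fin N) ℂ)) * EE V ((W₁ : Matrix (Fin N) (Fin N) ℂ) * exp ((((isChartRep_specialUnitaryGroup (n := Fin N)).transition k₁ X₁ : (specialUnitaryLogChart (Fin N)).lie) : (specialUnitaryLogChart (Fin N)).lie) : Matrix (Fin N) (Fin N) ℂ)) - 1‖ < _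
    rw [hT₁0, hone_W₁, sub_self, norm_zero]; exact innerRadius_pos
  -- Step 1: the factorisation `σ = T_{k₂} ∘ σ₁ ∘ T_{k₁}` near `X₁`
  have hEq : σ =ᶠ[𝓝 X₁] fun X => (isChartRep_specialUnitaryGroup (n := Fin N)).transition k₂ (σ₁ ((isChartRep_specialUnitaryGroup (n := Fin N)).transition k₁ X)) := by
    filter_upwards [evA, evB, evC, evD] with X hA hB hC hD
    have hkX : ‖(((E b)⁻¹ * E (b * (isChartRep_specialUnitaryGroup (n := Fin N)).expChart X) : SU N) : Matrix (Fin N) (Fin N) ℂ) - 1‖ < innerRadius (specialUnitaryLogChart (Fin N)) := by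
      rw [← hmodel_b hA]; exact hB
    have hσX : σ X = (isChartRep_specialUnitaryGroup (n := Fin N)).logChart ((E b)⁻¹ * E (b * (isChartRep_specialUnitaryGroup (n := Fin N)).expChart X)) := by
      have := modelChart_apply_eq_logChart U c EE hEE Φ hΦ hbs hA (by rw [← hE]; exact hkX)
      rw [hσ, hV, hE]; exact this
    have hΘT₁ : (isChartRep_specialUnitaryGroup (n := Fin N)).expChart ((isChartRep_specialUnitaryGroup (n := Fin N)).transition k₁ X) = k₁ * (isChartRep_specialUnitaryGroup (n := Fin N)).expChart X := by
      rw [hh] at hC; exact (isChartRep_specialUnitaryGroup (n := Fin N)).expChart_transition le_rfl hC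
    have hWX : W₁ * (isChartRep_specialUnitaryGroup (n := Fin N)).expChart ((isChartRep_specialUnitaryGroup (n := Fin N)).transition k₁ X) = b * (isChartRep_specialUnitaryGroup (n := Fin N)).expChart X := by
      rw [hΘT₁, hk₁, mul_assoc, mul_inv_cancel_left]
    have hAY : FibreSmall (expMeanLogSU (n := Fin N)) U c (W₁ * (isChartRep_specialUnitaryGroup (n := Fin N)).expChart ((isChartRep_specialUnitaryGroup (n := Fin N)).transition k₁ X)) := by rw [hWX]; exact hA
    have hkY : ‖(((E W₁)⁻¹ * E (W₁ * (isChartRep_specialUnitaryGroup (n := Fin N)).expChart ((isChartRep_specialUnitaryGroup (n := Fin N)).transition k₁ X)) : SU N) : Matrix (Fin N) (Fin N) ℂ) - 1‖ < innerRadius (specialUnitaryLogChart (Fin N)) := by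
      rw [← hmodel_W₁ hAY]; exact hD
    have hσ₁Y : σ₁ ((isChartRep_specialUnitaryGroup (n := Fin N)).transition k₁ X) = (isChartRep_specialUnitaryGroup (n := Fin N)).logChart ((E W₁)⁻¹ * E (W₁ * (isChartRep_specialUnitaryGroup (n := Fin N)).expChart ((isChartRep_specialUnitaryGroup (n := Fin N)).transition k₁ X))) := by
      have := modelChart_apply_eq_logChart U c EE hEE Φ hΦ hW₁s hAY (by rw [← hE]; exact hkY)
      rw [hσ₁, hV, hE]; exact this
    have hkY' : ‖fundamentalRep (Fin N) ((E W₁)⁻¹ * E (W₁ * (isChartRep_specialUnitaryGroup (n := Fin N)).expChart ((isChartRep_specialUnitaryGroup (n := Fin N)).transition k₁ X))) - 1‖ < innerRadius (specialUnitaryLogChart (Fin N)) := by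
      rw [fundamentalRep_apply]; exact hkY
    have hΘσ₁ : (isChartRep_specialUnitaryGroup (n := Fin N)).expChart (σ₁ ((isChartRep_specialUnitaryGroup (n := Fin N)).transition k₁ X)) = (E W₁)⁻¹ * E (b * (isChartRep_specialUnitaryGroup (n := Fin N)).expChart X) := by
      rw [hσ₁Y, (isChartRep_specialUnitaryGroup (n := Fin N)).expChart_logChart hkY', hWX]
    show σ X = (isChartRep_specialUnitaryGroup (n := Fin N)).logChart (k₂ * (isChartRep_specialUnitaryGroup (n := Fin N)).expChart (σ₁ ((isChartRep_specialUnitaryGroup (n := Fin N)).transition k₁ X)))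
    rw [hσX, hΘσ₁, hk₂, mul_assoc, mul_inv_cancel_left]
  -- Step 2: the chain rule and the determinants
  have hT₂ := differentiableAt_transition_and_det_ne_zero (isChartRep_specialUnitaryGroup (n := Fin N)) (lie_adStable_specialUnitaryGroup (n := Fin N)) (k := k₂) (X := (0 : (specialUnitaryLogChart (Fin N)).lie))
    (by rw [norm_zero]; exact chartRadius_pos) (by rw [IsChartRep.expChart_zero, mul_one, ← hh, hk₂]; exact hk₂mem)
  have hσ₁D := (coe_sliceDeriv_apply hj U c hαδ EE hEE Φ hΦ hW₁' 0).1
  have hD₁ := det_sliceDeriv_ne_zero hj U c hα24 hαδ hαL EE hEE Φ hΦ hW₁'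
  rw [← hV] at hσ₁D hD₁
  have hσ₁0 : σ₁ 0 = 0 := by
    have hk0 : ‖(((E W₁)⁻¹ * E (W₁ * (isChartRep_specialUnitaryGroup (n := Fin N)).expChart 0) : SU N) : Matrix (Fin N) (Fin N) ℂ) - 1‖ < innerRadius (specialUnitaryLogChart (Fin N)) := by
      rw [IsChartRep.expChart_zero, mul_one, inv_mul_cancel, OneMemClass.coe_one, sub_self, norm_zero]; exact innerRadius_pos
    have := modelChart_apply_eq_logChart U c EE hEE Φ hΦ hW₁s hW₁0s (by rw [← hE]; exact hk0)
    rw [hσ₁, hV]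
    show Φ ((fun i => ((openHol U c i : SU N) : Matrix (Fin N) (Fin N) ℂ), (W₁ : Matrix (Fin N) (Fin N) ℂ)), 0) = 0
    rw [this, IsChartRep.expChart_zero, mul_one, inv_mul_cancel, ← (isChartRep_specialUnitaryGroup (n := Fin N)).expChart_zero, (isChartRep_specialUnitaryGroup (n := Fin N)).logChart_expChart (by rw [norm_zero]; exact chartRadius_pos)]
  have hc1 : HasFDerivAt (fun X => σ₁ ((isChartRep_specialUnitaryGroup (n := Fin N)).transition k₁ X))
      ((((fderiv ℝ Φ ((V, (W₁ : Matrix (Fin N) (Fin N) ℂ)), 0)).comp (ContinuousLinearMap.inr ℝ ((Idx P → Matrix (Fin N) (Fin N) ℂ) × Matrix (Fin N) (Fin N) ℂ) (specialUnitaryLogChart (Fin N)).lie))).comp (fderiv ℝ ((isChartRep_specialUnitaryGroup (n := Fin N)).transition k₁) X₁)) X₁ := by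
    have hd : HasFDerivAt σ₁ ((fderiv ℝ Φ ((V, (W₁ : Matrix (Fin N) (Fin N) ℂ)), 0)).comp (ContinuousLinearMap.inr ℝ ((Idx P → Matrix (Fin N) (Fin N) ℂ) × Matrix (Fin N) (Fin N) ℂ) (specialUnitaryLogChart (Fin N)).lie)) ((isChartRep_specialUnitaryGroup (n := Fin N)).transition k₁ X₁) := by
      rw [hT₁0, hσ₁]; exact hσ₁D
    exact hd.comp X₁ hT₁.1.hasFDerivAt
  have hc2 : HasFDerivAt (fun X => (isChartRep_specialUnitaryGroup (n := Fin N)).transition k₂ (σ₁ ((isChartRep_specialUnitaryGroup (n := Fin N)).transition k₁ X)))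
      ((fderiv ℝ ((isChartRep_specialUnitaryGroup (n := Fin N)).transition k₂) 0).comp ((((fderiv ℝ Φ ((V, (W₁ : Matrix (Fin N) (Fin N) ℂ)), 0)).comp (ContinuousLinearMap.inr ℝ ((Idx P → Matrix (Fin N) (Fin N) ℂ) × Matrix (Fin N) (Fin N) ℂ) (specialUnitaryLogChart (Fin N)).lie))).comp
        (fderiv ℝ ((isChartRep_specialUnitaryGroup (n := Fin N)).transition k₁) X₁))) X₁ := by
    have hd2 : HasFDerivAt ((isChartRep_specialUnitaryGroup (n := Fin N)).transition k₂) (fderiv ℝ ((isChartRep_specialUnitaryGroup (n := Fin N)).transition k₂) 0) (σ₁ ((isChartRep_specialUnitaryGroup (n := Fin N)).transition k₁ X₁)) := by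
      rw [hT₁0, hσ₁0]; exact hT₂.1.hasFDerivAt
    exact hd2.comp X₁ hc1
  have hσF : HasFDerivAt σ ((fderiv ℝ ((isChartRep_specialUnitaryGroup (n := Fin N)).transition k₂) 0).comp ((((fderiv ℝ Φ ((V, (W₁ : Matrix (Fin N) (Fin N) ℂ)), 0)).comp (ContinuousLinearMap.inr ℝ ((Idx P → Matrix (Fin N) (Fin N) ℂ) × Matrix (Fin N) (Fin N) ℂ) (specialUnitaryLogChart (Fin N)).lie))).comp
        (fderiv ℝ ((isChartRep_specialUnitaryGroup (n := Fin N)).transition k₁) X₁))) X₁ := hc2.congr_of_eventuallyEq hEq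
  -- the derivative of the slice at base `b` through `Φ`
  have hΦd : ContDiffAt ℝ ⊤ Φ ((V, (b : Matrix (Fin N) (Fin N) ℂ)), X₁) := by
    refine contDiffAt_modelChart c EE hEE Φ hΦ hfamb (by rw [hcoeW₁]; exact hfamW₁) ?_
    rw [hmodel_b hbX₁s, ← hh, ← hW₁def]; exact hk₂norm.trans_lt h19one
  have hσF' : HasFDerivAt σ ((fderiv ℝ Φ ((V, (b : Matrix (Fin N) (Fin N) ℂ)), X₁)).comp (ContinuousLinearMap.inr ℝ ((Idx P → Matrix (Fin N) (Fin N) ℂ) × Matrix (Fin N) (Fin N) ℂ) (specialUnitaryLogChart (Fin N)).lie)) X₁ := by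
    rw [hσ]; exact ((hΦd.differentiableAt (by simp)).hasFDerivAt).comp X₁ (hasFDerivAt_prodMk_right _ X₁)
  have hEqL := hσF'.unique hσF
  suffices H : ((fderiv ℝ Φ ((V, (b : Matrix (Fin N) (Fin N) ℂ)), X₁)).comp (ContinuousLinearMap.inr ℝ ((Idx P → Matrix (Fin N) (Fin N) ℂ) × Matrix (Fin N) (Fin N) ℂ) (specialUnitaryLogChart (Fin N)).lie)).det ≠ 0 by
    rw [hV, hb] at H; exact H
  rw [hEqL]
  show LinearMap.det ((fderiv ℝ ((isChartRep_specialUnitaryGroup (n := Fin N)).transition k₂) 0 : (specialUnitaryLogChart (Fin N)).lie →ₗ[ℝ] (specialUnitaryLogChart (Fin N)).lie) ∘ₗ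
    ((((fderiv ℝ Φ ((V, (W₁ : Matrix (Fin N) (Fin N) ℂ)), 0)).comp (ContinuousLinearMap.inr ℝ ((Idx P → Matrix (Fin N) (Fin N) ℂ) × Matrix (Fin N) (Fin N) ℂ) (specialUnitaryLogChart (Fin N)).lie) : (specialUnitaryLogChart (Fin N)).lie →L[ℝ] (specialUnitaryLogChart (Fin N)).lie) : (specialUnitaryLogChart (Fin N)).lie →ₗ[ℝ] (specialUnitaryLogChart (Fin N)).lie) ∘ₗ
      (fderiv ℝ ((isChartRep_specialUnitaryGroup (n := Fin N)).transition k₁) X₁ : (specialUnitaryLogChart (Fin N)).lie →ₗ[ℝ] (specialUnitaryLogChart (Fin N)).lie))) ≠ 0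
  rw [LinearMap.det_comp, LinearMap.det_comp]
  exact mul_ne_zero hT₂.2 (mul_ne_zero hD₁ hT₁.2)


end Cocycle

/-! ## §4  The Jacobian of the forward law is positive and finite at every point of the window -/

section Positive

/-- `jacDensity x ≠ 0` on the chart ball (`‖x‖ < s_C ≤ 1∕2`). [cite: Helgason2000, Ch. I §1 Thm. 1.14 (12) p. 96] -/
theorem jacDensity_ne_zero_of_norm_lt {x : (specialUnitaryLogChart (Fin N)).lie} (hx : ‖x‖ < chartRadius (specialUnitaryLogChart (Fin N))) :
    jacDensity (lie_adStable_specialUnitaryGroup (n := Fin N)) x ≠ 0 := by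
  have hx' : ‖x‖ ≤ 1 / 2 := (hx.le.trans chartRadius_le_innerRadius).trans innerRadius_le_half
  have hdet := det_jac_ne_zero_of_norm_le_half (lie_adStable_specialUnitaryGroup (n := Fin N)) hx'
  rw [jacDensity_def]
  exact fun h0 => not_le.2 (abs_pos.2 hdet) (ENNReal.ofReal_eq_zero.1 h0)

/-- ★★★ **THE JACOBIAN OF THE FORWARD LAW IS POSITIVE AND FINITE ON THE CENTRAL `α`-WINDOW**: for `W ∈ S`, with `b = V_{i₀}`, `X = Λ(b⁻¹W)`:
`J(W) = |det jac(Φ(par,X))|·|det D_XΦ(par,X)| ∕ |det jac(X)| ∈ (0, ∞)`. [cite: Balaban1987RG1, (2.10) p.267; Helgason2000, Ch. I §1 Thm. 1.14 (12)-(13) p. 96] -/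
theorem jacobian_ne_zero_and_ne_top_of_mem (hj : j + 1 ≤ P.m + P.K) (U : GaugeField P j (SU N)) (c : PBond P (j + 1)) {α : ℝ}
    (hα0 : 0 ≤ α) (hα24 : α ≤ 1 / 24) (hα64 : 64 * α ≤ deltaSU (Fin N)) (hαL : 157 * α < ((P.L : ℝ) ^ (P.d - 1))⁻¹)
    {i₀ : Idx P} (hi₀ : ¬ IsCentral c i₀)
    (EE : (Idx P → Matrix (Fin N) (Fin N) ℂ) → Matrix (Fin N) (Fin N) ℂ → Matrix (Fin N) (Fin N) ℂ)
    (hEE : ∀ V A, EE V A = eml (fun i : Idx P => if IsCentral c i then (1 : Matrix (Fin N) (Fin N) ℂ) else V i * star A) * A)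
    (Φ : ((Idx P → Matrix (Fin N) (Fin N) ℂ) × Matrix (Fin N) (Fin N) ℂ) × (specialUnitaryLogChart (Fin N)).lie → (specialUnitaryLogChart (Fin N)).lie)
    (hΦ : ∀ p, Φ p = HaarExpChartLocal.proj (specialUnitaryLogChart (Fin N))
      (mlog (star (EE p.1.1 p.1.2) * EE p.1.1 (p.1.2 * exp ((p.2 : (specialUnitaryLogChart (Fin N)).lie) : Matrix (Fin N) (Fin N) ℂ)))))
    {W : SU N} (hW : ∀ i : Idx P, dist1 (fibreFamily U c W i) ≤ α) :
    jacDensity (lie_adStable_specialUnitaryGroup (n := Fin N))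
          (Φ ((fun i => ((openHol U c i : SU N) : Matrix (Fin N) (Fin N) ℂ), ((openHol U c i₀ : SU N) : Matrix (Fin N) (Fin N) ℂ)), (isChartRep_specialUnitaryGroup (n := Fin N)).logChart ((openHol U c i₀)⁻¹ * W))) *
        ENNReal.ofReal |((fderiv ℝ Φ ((fun i => ((openHol U c i : SU N) : Matrix (Fin N) (Fin N) ℂ), ((openHol U c i₀ : SU N) : Matrix (Fin N) (Fin N) ℂ)), (isChartRep_specialUnitaryGroup (n := Fin N)).logChart ((openHol U c i₀)⁻¹ * W))).comp
          (ContinuousLinearMap.inr ℝ ((Idx P → Matrix (Fin N) (Fin N) ℂ) × Matrix (Fin N) (Fin N) ℂ) (specialUnitaryLogChart (Fin N)).lie)).det| /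
        jacDensity (lie_adStable_specialUnitaryGroup (n := Fin N)) ((isChartRep_specialUnitaryGroup (n := Fin N)).logChart ((openHol U c i₀)⁻¹ * W)) ≠ 0 ∧
    jacDensity (lie_adStable_specialUnitaryGroup (n := Fin N))
          (Φ ((fun i => ((openHol U c i : SU N) : Matrix (Fin N) (Fin N) ℂ), ((openHol U c i₀ : SU N) : Matrix (Fin N) (Fin N) ℂ)), (isChartRep_specialUnitaryGroup (n := Fin N)).logChart ((openHol U c i₀)⁻¹ * W))) *
        ENNReal.ofReal |((fderiv ℝ Φ ((fun i => ((openHol U c i : SU N) : Matrix (Fin N) (Fin N) ℂ), ((openHol U c i₀ : SU N) : Matrix (Fin N) (Fin N) ℂ)), (isChartRep_specialUnitaryGroup (n := Fin N)).logChart ((openHol U c i₀)⁻¹ * W))).comp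
          (ContinuousLinearMap.inr ℝ ((Idx P → Matrix (Fin N) (Fin N) ℂ) × Matrix (Fin N) (Fin N) ℂ) (specialUnitaryLogChart (Fin N)).lie)).det| /
        jacDensity (lie_adStable_specialUnitaryGroup (n := Fin N)) ((isChartRep_specialUnitaryGroup (n := Fin N)).logChart ((openHol U c i₀)⁻¹ * W)) ≠ ⊤ := by
  obtain ⟨h19r, h38s, h19half, h2αδ, h19one⟩ := radii_of_le_deltaSU (N := N) hα0 hα64
  have hαδ : α < deltaSU (Fin N) := by linarith
  have hWs : FibreSmall (expMeanLogSU (n := Fin N)) U c W := fibreSmall_of_mem_window U c hαδ hW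
  have hbs : FibreSmall (expMeanLogSU (n := Fin N)) U c (openHol U c i₀) := fibreSmall_openHol_of_mem_window U c hα0 h2αδ hW hi₀
  -- the source point `b⁻¹W` lies in the chart window
  have hk : (openHol U c i₀)⁻¹ * W ∈ (isChartRep_specialUnitaryGroup (n := Fin N)).window (chartRadius (specialUnitaryLogChart (Fin N))) := by
    refine mem_window_of_norm_sub_one_le (t := α) ?_ (by linarith) (by linarith) (by linarith)
    rw [norm_coe_inv_mul_sub_one, norm_sub_rev]; exact norm_openHol_sub_le_of_mem U c hW hi₀
  have hX : ‖(isChartRep_specialUnitaryGroup (n := Fin N)).logChart ((openHol U c i₀)⁻¹ * W)‖ < chartRadius (specialUnitaryLogChart (Fin N)) :=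
    mem_ball_zero_iff.1 ((isChartRep_specialUnitaryGroup (n := Fin N)).logChart_mem_ball le_rfl hk)
  have hbΘ : openHol U c i₀ * (isChartRep_specialUnitaryGroup (n := Fin N)).expChart ((isChartRep_specialUnitaryGroup (n := Fin N)).logChart ((openHol U c i₀)⁻¹ * W)) = W := by
    rw [(isChartRep_specialUnitaryGroup (n := Fin N)).expChart_logChart_of_mem_window le_rfl hk, mul_inv_cancel_left]
  -- the determinant of the slice derivative
  have hdet := det_sliceDeriv_ne_zero_of_mem hj U c hα0 hα24 hα64 hαL hi₀ EE hEE Φ hΦ hX (by rw [hbΘ]; exact hW)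
  -- the target point lies in the chart ball
  have hΦX : Φ ((fun i => ((openHol U c i : SU N) : Matrix (Fin N) (Fin N) ℂ), ((openHol U c i₀ : SU N) : Matrix (Fin N) (Fin N) ℂ)), (isChartRep_specialUnitaryGroup (n := Fin N)).logChart ((openHol U c i₀)⁻¹ * W)) =
      (isChartRep_specialUnitaryGroup (n := Fin N)).logChart ((fibreMap (expMeanLogSU (n := Fin N)) U c (openHol U c i₀))⁻¹ * fibreMap (expMeanLogSU (n := Fin N)) U c W) := by
    have hk19 : ‖(((fibreMap (expMeanLogSU (n := Fin N)) U c (openHol U c i₀))⁻¹ *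
        fibreMap (expMeanLogSU (n := Fin N)) U c (openHol U c i₀ * (isChartRep_specialUnitaryGroup (n := Fin N)).expChart ((isChartRep_specialUnitaryGroup (n := Fin N)).logChart ((openHol U c i₀)⁻¹ * W))) : SU N) : Matrix (Fin N) (Fin N) ℂ) - 1‖ <
        innerRadius (specialUnitaryLogChart (Fin N)) := by
      rw [hbΘ]; exact (norm_coe_fibreMap_inv_mul_sub_one_le U c hα0 (by linarith) h2αδ hW hi₀).trans_lt h19r
    have := modelChart_apply_eq_logChart U c EE hEE Φ hΦ hbs (by rw [hbΘ]; exact hWs) hk19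
    rw [this, hbΘ]
  have hk' : (fibreMap (expMeanLogSU (n := Fin N)) U c (openHol U c i₀))⁻¹ * fibreMap (expMeanLogSU (n := Fin N)) U c W ∈
      (isChartRep_specialUnitaryGroup (n := Fin N)).window (chartRadius (specialUnitaryLogChart (Fin N))) :=
    mem_window_of_norm_sub_one_le (norm_coe_fibreMap_inv_mul_sub_one_le U c hα0 (by linarith) h2αδ hW hi₀) h19r h38s h19half
  have hΦX' : ‖Φ ((fun i => ((openHol U c i : SU N) : Matrix (Fin N) (Fin N) ℂ), ((openHol U c i₀ : SU N) : Matrix (Fin N) (Fin N) ℂ)), (isChartRep_specialUnitaryGroup (n := Fin N)).logChart ((openHol U c i₀)⁻¹ * W))‖ <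
      chartRadius (specialUnitaryLogChart (Fin N)) := by
    rw [hΦX]; exact mem_ball_zero_iff.1 ((isChartRep_specialUnitaryGroup (n := Fin N)).logChart_mem_ball le_rfl hk')
  have h1 := jacDensity_ne_zero_of_norm_lt (N := N) hΦX'
  have h2 : ENNReal.ofReal |((fderiv ℝ Φ ((fun i => ((openHol U c i : SU N) : Matrix (Fin N) (Fin N) ℂ), ((openHol U c i₀ : SU N) : Matrix (Fin N) (Fin N) ℂ)), (isChartRep_specialUnitaryGroup (n := Fin N)).logChart ((openHol U c i₀)⁻¹ * W))).comp
      (ContinuousLinearMap.inr ℝ ((Idx P → Matrix (Fin N) (Fin N) ℂ) × Matrix (Fin N) (Fin N) ℂ) (specialUnitaryLogChart (Fin N)).lie)).det| ≠ 0 :=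
    fun h0 => not_le.2 (abs_pos.2 hdet) (ENNReal.ofReal_eq_zero.1 h0)
  have h3 := jacDensity_ne_zero_of_norm_lt (N := N) hX
  have h3top : jacDensity (lie_adStable_specialUnitaryGroup (n := Fin N)) ((isChartRep_specialUnitaryGroup (n := Fin N)).logChart ((openHol U c i₀)⁻¹ * W)) ≠ ⊤ := by
    rw [jacDensity_def]; exact ENNReal.ofReal_ne_top
  have h1top : jacDensity (lie_adStable_specialUnitaryGroup (n := Fin N))
      (Φ ((fun i => ((openHol U c i : SU N) : Matrix (Fin N) (Fin N) ℂ), ((openHol U c i₀ : SU N) : Matrix (Fin N) (Fin N) ℂ)), (isChartRep_specialUnitaryGroup (n := Fin N)).logChart ((openHol U c i₀)⁻¹ * W))) ≠ ⊤ := by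
    rw [jacDensity_def]; exact ENNReal.ofReal_ne_top
  exact ⟨(ENNReal.div_pos (mul_ne_zero h1 h2) h3top).ne', (ENNReal.div_lt_top (ENNReal.mul_ne_top h1top ENNReal.ofReal_ne_top) h3).ne⟩

/-- **On the window the first factor of the density reads `Λ(E(b)⁻¹·E(W))`**: `Φ((V(U),↑b), Λ(b⁻¹W)) = Λ(E(b)⁻¹E(W))` for `W ∈ S`, `b = V_{i₀}` (`0 ≤ α`, `64·α ≤ δ_N`).
[cite: Balaban1987RG1, (2.10) p.267; Helgason2000, Ch. I §1 Thm. 1.14 (13) p. 96] -/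
theorem modelChart_at_logChart_eq (U : GaugeField P j (SU N)) (c : PBond P (j + 1)) {α : ℝ} (hα0 : 0 ≤ α) (hα64 : 64 * α ≤ deltaSU (Fin N))
    {i₀ : Idx P} (hi₀ : ¬ IsCentral c i₀)
    (EE : (Idx P → Matrix (Fin N) (Fin N) ℂ) → Matrix (Fin N) (Fin N) ℂ → Matrix (Fin N) (Fin N) ℂ)
    (hEE : ∀ V A, EE V A = eml (fun i : Idx P => if IsCentral c i then (1 : Matrix (Fin N) (Fin N) ℂ) else V i * star A) * A)
    (Φ : ((Idx P → Matrix (Fin N) (Fin N) ℂ) × Matrix (Fin N) (Fin N) ℂ) × (specialUnitaryLogChart (Fin N)).lie → (specialUnitaryLogChart (Fin N)).lie)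
    (hΦ : ∀ p, Φ p = HaarExpChartLocal.proj (specialUnitaryLogChart (Fin N))
      (mlog (star (EE p.1.1 p.1.2) * EE p.1.1 (p.1.2 * exp ((p.2 : (specialUnitaryLogChart (Fin N)).lie) : Matrix (Fin N) (Fin N) ℂ)))))
    {W : SU N} (hW : ∀ i : Idx P, dist1 (fibreFamily U c W i) ≤ α) :
    Φ ((fun i => ((openHol U c i : SU N) : Matrix (Fin N) (Fin N) ℂ), ((openHol U c i₀ : SU N) : Matrix (Fin N) (Fin N) ℂ)), (isChartRep_specialUnitaryGroup (n := Fin N)).logChart ((openHol U c i₀)⁻¹ * W)) =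
      (isChartRep_specialUnitaryGroup (n := Fin N)).logChart ((fibreMap (expMeanLogSU (n := Fin N)) U c (openHol U c i₀))⁻¹ * fibreMap (expMeanLogSU (n := Fin N)) U c W) := by
  obtain ⟨h19r, h38s, h19half, h2αδ, h19one⟩ := radii_of_le_deltaSU (N := N) hα0 hα64
  have hαδ : α < deltaSU (Fin N) := by linarith
  have hWs : FibreSmall (expMeanLogSU (n := Fin N)) U c W := fibreSmall_of_mem_window U c hαδ hW
  have hbs : FibreSmall (expMeanLogSU (n := Fin N)) U c (openHol U c i₀) := fibreSmall_openHol_of_mem_window U c hα0 h2αδ hW hi₀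
  have hk : (openHol U c i₀)⁻¹ * W ∈ (isChartRep_specialUnitaryGroup (n := Fin N)).window (chartRadius (specialUnitaryLogChart (Fin N))) := by
    refine mem_window_of_norm_sub_one_le (t := α) ?_ (by linarith) (by linarith) (by linarith)
    rw [norm_coe_inv_mul_sub_one, norm_sub_rev]; exact norm_openHol_sub_le_of_mem U c hW hi₀
  have hbΘ : openHol U c i₀ * (isChartRep_specialUnitaryGroup (n := Fin N)).expChart ((isChartRep_specialUnitaryGroup (n := Fin N)).logChart ((openHol U c i₀)⁻¹ * W)) = W := by
    rw [(isChartRep_specialUnitaryGroup (n := Fin N)).expChart_logChart_of_mem_window le_rfl hk, mul_inv_cancel_left]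
  have hk19 : ‖(((fibreMap (expMeanLogSU (n := Fin N)) U c (openHol U c i₀))⁻¹ *
      fibreMap (expMeanLogSU (n := Fin N)) U c (openHol U c i₀ * (isChartRep_specialUnitaryGroup (n := Fin N)).expChart ((isChartRep_specialUnitaryGroup (n := Fin N)).logChart ((openHol U c i₀)⁻¹ * W))) : SU N) : Matrix (Fin N) (Fin N) ℂ) - 1‖ <
      innerRadius (specialUnitaryLogChart (Fin N)) := by
    rw [hbΘ]; exact (norm_coe_fibreMap_inv_mul_sub_one_le U c hα0 (by linarith) h2αδ hW hi₀).trans_lt h19r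
  have := modelChart_apply_eq_logChart U c EE hEE Φ hΦ hbs (by rw [hbΘ]; exact hWs) hk19
  rw [this, hbΘ]

end Positive

end Summit.QuantumFields.YangMills.BalabanUVNodes.N09CentralWindowNondegenerate
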